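import Summits.MatrixMultiplication.OmegaCensus.BoxBadAtomsFrobeniusBridge
import Summits.MatrixMultiplication.OmegaCensus.SchmidtAtomsQ5

/-!
# ω-census, family (b3): conjecture C9 (b) — the full-cyclotomic bridge (`p` a primitive root mod `q`), and the atoms `A(2,5)`, `A(3,5)` in relation form

HONEST FRAMING (pub-omega census; verbatim): lottery ticket; floor = certified bounds/negative ranges.
Census BOOKKEEPING (conjecture C9 of the cell, STRUCTURE.md §2, `BoxRatioSectionLaw`; pub-omega kernel-l4 gen 17, task K-5″).
Nothing here is progress on `ω`.

When `p` is a primitive root modulo the prime `q` (`ord_q p = q − 1`, the cyclotomic polynomial `Φ_q` irreducible mod `p`), the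
module `W = ⟨yⁱ a y⁻ⁱ⟩` of an `AtomConfig p q a y` is the field `𝔽_{p^{q−1}}` with `y` acting as multiplication by a primitive
`q`-th root of unity `ζ`.  This file bridges a CONCRETE kernel model `R ⋊_ζ ℤ/q` (a commutative ring `R` given with coordinates
`λ : R → 𝔽_p^{q−1}` in the basis `1, ζ, …, ζ^{q−2}`) to the relation form:
* `Cyclo.shift` — the companion shift of multiplication by `ζ` on coordinates (`ζ^{q−1} = −(1 + ζ + ⋯ + ζ^{q−2})`);
* `Cyclo.atomBad_of_model` — given `λ` additive and bijective with `λ(ζ r) = shift (λ r)`, `ζ^q = 1 ≠ ζ`, `ζ r = r ⇒ r = 0`, the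
  transitivity of the shift algebra on non-zero vectors (`reach`: each `d ≠ 0` is carried to `e₀` by some `Σ εⱼ shiftʲ`), and
  `¬ BoxUseful (RCyc R q ζ)`: **`AtomBad p q`**.  Group side: the exponent map `E(d) = ∏ cᵢ^{dᵢ}` on `W` is a homomorphism,
  intertwines the shift with conjugation by `y` (the trace relation gives `c_{q−1} = (∏ cᵢ)⁻¹`), and is injective by `reach`;
  then `RCyc.lift`/`redHom` as in `BoxBadAtomsFrobeniusBridge`.
* Instances on stpp-1's models of `SchmidtAtomsQ5` (`𝔽₁₆ = F16`, `𝔽₈₁ = F81`, all side conditions by `decide`):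
  **`atomBad_2_5`** and **`atomBad_3_5`** — the atoms `A(2,5) = 𝔽₁₆ ⋊ C₅` and `A(3,5) = 𝔽₈₁ ⋊ C₅` in relation form.
-/

namespace Summit.MatrixMultiplication.OmegaCensus

open KeyLift Finset

universe u

namespace Cyclo

variable {p m : ℕ}

/-- The companion shift on `Fin (m+1) → ZMod p`: coordinates of `ζ · (Σ dⱼ ζʲ)` in the basis `1, ζ, …, ζ^m` when
`ζ^{m+1} = −(1 + ζ + ⋯ + ζ^m)`. [folklore] -/
def shift (d : Fin (m + 1) → ZMod p) : Fin (m + 1) → ZMod p :=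
  fun j => Fin.cases (-d (Fin.last m)) (fun i => d i.castSucc - d (Fin.last m)) j

/-- `shift d 0 = − d_last`. [folklore] -/
@[simp] theorem shift_zero (d : Fin (m + 1) → ZMod p) : shift d 0 = -d (Fin.last m) := by
  simp [shift]

/-- `shift d (i+1) = d_i − d_last`. [folklore] -/
@[simp] theorem shift_succ (d : Fin (m + 1) → ZMod p) (i : Fin m) : shift d i.succ = d i.castSucc - d (Fin.last m) := by
  simp [shift]

section Group

variable {W : Type*} [CommGroup W] [NeZero p]

/-- The exponent homomorphism `d ↦ ∏ᵢ cᵢ^{dᵢ}` for elements `cᵢ` of exponent `p` in a commutative group. [folklore] -/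
def expHom (c : Fin (m + 1) → W) (hc : ∀ i, c i ^ p = 1) : Multiplicative (Fin (m + 1) → ZMod p) →* W where
  toFun d := ∏ i, cycHom p (c i) (hc i) (Multiplicative.ofAdd (Multiplicative.toAdd d i))
  map_one' := by simp
  map_mul' d d' := by
    rw [← prod_mul_distrib]
    exact prod_congr rfl fun i _ => by rw [toAdd_mul, Pi.add_apply, ofAdd_add, map_mul]

/-- Value of `expHom` on `ofAdd d`. [folklore] -/
theorem expHom_ofAdd (c : Fin (m + 1) → W) (hc : ∀ i, c i ^ p = 1) (d : Fin (m + 1) → ZMod p) :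
    expHom c hc (Multiplicative.ofAdd d) = ∏ i, c i ^ (d i).val := by
  change ∏ i, cycHom p (c i) (hc i) (Multiplicative.ofAdd (d i)) = _
  rfl

/-- `expHom` on a basis vector. [folklore] -/
theorem expHom_single (c : Fin (m + 1) → W) (hc : ∀ i, c i ^ p = 1) (i : Fin (m + 1)) (x : ZMod p) :
    expHom c hc (Multiplicative.ofAdd (Pi.single i x)) = c i ^ x.val := by
  rw [expHom_ofAdd, prod_eq_single_of_mem i (mem_univ i)]
  · rw [Pi.single_eq_same]
  · intro j _ hj
    rw [Pi.single_eq_of_ne hj, ZMod.val_zero, pow_zero]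

/-- `expHom` of a scalar multiple. [folklore] -/
theorem expHom_smul (c : Fin (m + 1) → W) (hc : ∀ i, c i ^ p = 1) (ε : ZMod p) (d : Fin (m + 1) → ZMod p) :
    expHom c hc (Multiplicative.ofAdd (ε • d)) = expHom c hc (Multiplicative.ofAdd d) ^ ε.val := by
  have : ε • d = ε.val • d := by
    ext i; simp only [Pi.smul_apply, smul_eq_mul, nsmul_eq_mul, ZMod.natCast_zmod_val]
  rw [this, ofAdd_nsmul, map_pow]

/-- **The shift is conjugation.** If an endomorphism `φ` sends `cᵢ ↦ cᵢ₊₁` (`i < m`) and `c_m ↦ (∏ cᵢ)⁻¹`, then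
`φ (E d) = E (shift d)`. [folklore] -/
theorem map_expHom (c : Fin (m + 1) → W) (hc : ∀ i, c i ^ p = 1) (φ : W →* W)
    (hφ : ∀ i : Fin m, φ (c i.castSucc) = c i.succ) (hlast : φ (c (Fin.last m)) = (∏ i, c i)⁻¹)
    (d : Fin (m + 1) → ZMod p) :
    φ (expHom c hc (Multiplicative.ofAdd d)) = expHom c hc (Multiplicative.ofAdd (shift d)) := by
  -- left side
  have lhs : φ (expHom c hc (Multiplicative.ofAdd d)) =
      (∏ i : Fin m, c i.succ ^ (d i.castSucc).val) * ((∏ i, c i) ^ (d (Fin.last m)).val)⁻¹ := by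
    rw [expHom_ofAdd, map_prod, Fin.prod_univ_castSucc]
    congr 1
    · exact prod_congr rfl fun i _ => by rw [map_pow, hφ]
    · rw [map_pow, hlast, inv_pow]
  -- right side, through the `cycHom`s to handle negative coordinates
  have neg_pow : ∀ (i : Fin (m + 1)) (x : ZMod p), c i ^ (-x).val = (c i ^ x.val)⁻¹ := by
    intro i x
    rw [← cycHom_ofAdd p (c i) (hc i), ← cycHom_ofAdd p (c i) (hc i), ofAdd_neg, map_inv]
  have sub_pow : ∀ (i : Fin (m + 1)) (x z : ZMod p), c i ^ (x - z).val = c i ^ x.val * (c i ^ z.val)⁻¹ := by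
    intro i x z
    rw [← cycHom_ofAdd p (c i) (hc i), ← cycHom_ofAdd p (c i) (hc i), ← cycHom_ofAdd p (c i) (hc i), sub_eq_add_neg,
      ofAdd_add, ofAdd_neg, map_mul, map_inv]
  have rhs : expHom c hc (Multiplicative.ofAdd (shift d)) =
      (c 0 ^ (d (Fin.last m)).val)⁻¹ * ((∏ i : Fin m, c i.succ ^ (d i.castSucc).val) *
        (∏ i : Fin m, c i.succ ^ (d (Fin.last m)).val)⁻¹) := by
    rw [expHom_ofAdd, Fin.prod_univ_succ, shift_zero, neg_pow]
    congr 1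
    rw [← prod_inv_distrib, ← prod_mul_distrib]
    exact prod_congr rfl fun i _ => by rw [shift_succ, sub_pow]
  rw [lhs, rhs, ← prod_pow, Fin.prod_univ_succ, mul_inv]
  exact mul_left_comm _ _ _

/-- Iterating: `φ^j (E d) = E (shift^j d)`. [folklore] -/
theorem iterate_map_expHom (c : Fin (m + 1) → W) (hc : ∀ i, c i ^ p = 1) (φ : W →* W)
    (hφ : ∀ i : Fin m, φ (c i.castSucc) = c i.succ) (hlast : φ (c (Fin.last m)) = (∏ i, c i)⁻¹) (j : ℕ)
    (d : Fin (m + 1) → ZMod p) :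
    φ^[j] (expHom c hc (Multiplicative.ofAdd d)) = expHom c hc (Multiplicative.ofAdd (shift^[j] d)) := by
  induction j generalizing d with
  | zero => rfl
  | succ j ih => rw [Function.iterate_succ_apply, Function.iterate_succ_apply, map_expHom c hc φ hφ hlast, ih]

/-- **Injectivity of the exponent map** from the transitivity of the shift algebra: if every `d ≠ 0` is carried to `e₀` by some
`Σ εⱼ shiftʲ`, and `c₀ ≠ 1`, then `E` is injective (an element of the kernel gives `c₀ = E(e₀) = 1`). [folklore] -/
theorem expHom_injective [Fact (1 < p)] (c : Fin (m + 1) → W) (hc : ∀ i, c i ^ p = 1) (φ : W →* W)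
    (hφ : ∀ i : Fin m, φ (c i.castSucc) = c i.succ) (hlast : φ (c (Fin.last m)) = (∏ i, c i)⁻¹) (h0 : c 0 ≠ 1)
    (hreach : ∀ d : Fin (m + 1) → ZMod p, d ≠ 0 →
      ∃ ε : Fin (m + 1) → ZMod p, ∑ j : Fin (m + 1), ε j • shift^[j.val] d = Pi.single 0 1) :
    Function.Injective (expHom c hc) := by
  rw [injective_iff_map_eq_one]
  intro d hd
  by_contra hne
  have hd0 : Multiplicative.toAdd d ≠ 0 := fun h => hne (by rw [← ofAdd_toAdd d, h, ofAdd_zero])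
  obtain ⟨ε, hε⟩ := hreach _ hd0
  have key : expHom c hc (Multiplicative.ofAdd (∑ j : Fin (m + 1), ε j • shift^[j.val] (Multiplicative.toAdd d))) = 1 := by
    rw [ofAdd_sum, map_prod]
    refine prod_eq_one fun j _ => ?_
    rw [expHom_smul, ← iterate_map_expHom c hc φ hφ hlast, ofAdd_toAdd, hd, iterate_map_one, one_pow]
  rw [hε, expHom_single, ZMod.val_one, pow_one] at key
  exact h0 key

end Group

/-- **The full-cyclotomic bridge.**  Let `R` be a commutative ring with `ζ ∈ R`, `ζ^q = 1 ≠ ζ` (`q = m + 2` prime), and additive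
bijective coordinates `λ : R → (Fin (m+1) → ZMod p)` with `λ(ζ r) = shift (λ r)`, such that `ζ` fixes only `0` and the shift
algebra is transitive on non-zero vectors.  If `R ⋊_ζ ℤ/q` is box-useless then `AtomBad p q`. [folklore] -/
theorem atomBad_of_model (q : ℕ) (hmq : m + 2 = q) [Fact p.Prime] [Fact q.Prime] {R : Type} [CommRing R] [Fintype R]
    [DecidableEq R] (ζ : R) [hζ : Fact (ζ ^ q = 1)] (hζ1 : ζ ≠ 1) (lam : R →+ (Fin (m + 1) → ZMod p))
    (hbij : Function.Bijective lam) (hmul : ∀ r, lam (ζ * r) = shift (lam r)) (hfix : ∀ r, ζ * r = r → r = 0)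
    (hreach : ∀ d : Fin (m + 1) → ZMod p, d ≠ 0 →
      ∃ ε : Fin (m + 1) → ZMod p, ∑ j : Fin (m + 1), ε j • shift^[j.val] d = Pi.single 0 1)
    (hbad : ¬ BoxUseful (RCyc R q ζ)) : AtomBad.{u} p q := by
  subst hmq
  intro H _ _ _ a y h
  classical
  have hp : p.Prime := Fact.out
  haveI : NeZero p := ⟨hp.ne_zero⟩
  obtain ⟨ha1, hap, hcomm, hyq, htr⟩ := h
  -- the abelian subgroup `W` generated by the conjugates, conjugation `φ` by `y`
  let c' : ℕ → H := fun i => y ^ i * a * (y ^ i)⁻¹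
  set W : Subgroup H := Subgroup.closure (Set.range c') with hWdef
  have hSc : ∀ x ∈ Set.range c', ∀ z ∈ Set.range c', x * z = z * x := by
    rintro x ⟨i, rfl⟩ z ⟨j, rfl⟩; exact (hcomm i j).eq
  letI : CommGroup W :=
    { (inferInstance : Group W) with mul_comm := (Subgroup.isMulCommutative_closure hSc).is_comm.comm }
  have hc'mem : ∀ i, c' i ∈ W := fun i => Subgroup.subset_closure ⟨i, rfl⟩
  have hc'succ : ∀ i, y * c' i * y⁻¹ = c' (i + 1) := by
    intro i; change y * (y ^ i * a * (y ^ i)⁻¹) * y⁻¹ = y ^ (i + 1) * a * (y ^ (i + 1))⁻¹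
    rw [pow_succ']; group
  have hyW : ∀ x ∈ W, y * x * y⁻¹ ∈ W := by
    intro x hx
    have hmap : W.map (MulAut.conj y).toMonoidHom ≤ W := by
      rw [hWdef, MonoidHom.map_closure]
      refine Subgroup.closure_le _ |>.2 ?_
      rintro _ ⟨_, ⟨i, rfl⟩, rfl⟩
      change y * c' i * y⁻¹ ∈ Subgroup.closure (Set.range c')
      rw [hc'succ]
      exact Subgroup.subset_closure ⟨i + 1, rfl⟩
    exact hmap ⟨x, hx, rfl⟩
  let φ : W →* W := ((MulAut.conj y).toMonoidHom.comp W.subtype).codRestrict W (fun x => hyW x x.2)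
  have hφ_coe : ∀ x : W, ((φ x : W) : H) = y * x * y⁻¹ := fun x => rfl
  let cW : ℕ → W := fun i => ⟨c' i, hc'mem i⟩
  have hcWp : ∀ i, cW i ^ p = 1 := by
    intro i; apply Subtype.ext
    change (y ^ i * a * (y ^ i)⁻¹) ^ p = 1
    rw [← MulAut.conj_apply, ← map_pow, hap, map_one]
  have hφcW : ∀ i, φ (cW i) = cW (i + 1) := fun i => Subtype.ext (hc'succ i)
  have hprod : ∀ n, ((∏ i ∈ range n, cW i : W) : H) = conjTrace y a n := by
    intro n
    induction n with
    | zero => simp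
    | succ n ih => rw [prod_range_succ, Subgroup.coe_mul, ih, conjTrace_succ']
  have htr' : ∏ i ∈ range (m + 2), cW i = 1 := Subtype.ext (by rw [hprod, htr]; rfl)
  -- the rank-`(m+1)` frame
  let c : Fin (m + 1) → W := fun i => cW i.val
  have hc : ∀ i, c i ^ p = 1 := fun i => hcWp i.val
  have hφc : ∀ i : Fin m, φ (c i.castSucc) = c i.succ := fun i => by
    change φ (cW i.val) = cW (i.val + 1); exact hφcW i.val
  have hlast : φ (c (Fin.last m)) = (∏ i, c i)⁻¹ := by
    change φ (cW m) = (∏ i : Fin (m + 1), cW i.val)⁻¹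
    rw [hφcW, ← Finset.prod_range (fun i => cW i), eq_inv_iff_mul_eq_one, mul_comm, ← prod_range_succ, htr']
  have h0 : c 0 ≠ 1 := by
    intro h
    have := congrArg Subtype.val h
    change y ^ 0 * a * (y ^ 0)⁻¹ = 1 at this
    rw [pow_zero, one_mul, inv_one, mul_one] at this
    exact ha1 this
  have hEinj := expHom_injective c hc φ hφc hlast h0 hreach
  -- the additive character `e = E ∘ λ`
  let e : Multiplicative R →* H := W.subtype.comp ((expHom c hc).comp (AddMonoidHom.toMultiplicative lam))
  have he_apply : ∀ r : R, e (Multiplicative.ofAdd r) = ((expHom c hc (Multiplicative.ofAdd (lam r)) : W) : H) := fun r => rfl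
  have he : Function.Injective e := by
    refine Subtype.val_injective.comp (hEinj.comp ?_)
    intro r s hrs
    exact Multiplicative.toAdd.injective (hbij.1 (Multiplicative.ofAdd.injective hrs))
  have hy' : ∀ r : R, y * e (Multiplicative.ofAdd r) * y⁻¹ = e (Multiplicative.ofAdd (ζ * r)) := by
    intro r
    rw [he_apply, he_apply, ← hφ_coe, map_expHom c hc φ hφc hlast, ← hmul]
  -- embed `R ⋊ ℤ/|y|`, reduce onto `R ⋊ ℤ/(m+2)`
  haveI : NeZero (orderOf y) := ⟨(orderOf_pos y).ne'⟩
  haveI hfact : Fact (ζ ^ orderOf y = 1) := ⟨RCyc.pow_orderOf_smul_eq e he y hy'⟩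
  have hyn : y ^ orderOf y = 1 := pow_orderOf_eq_one y
  have hinj : Function.Injective (RCyc.lift e y hyn hy') := by
    refine RCyc.lift_injective e y hyn hy' he fun t r htr2 => ?_
    have hcj : y * y ^ t.val * y⁻¹ = y ^ t.val := by group
    rw [htr2, hy' r] at hcj
    have hr : ζ * r = r := Multiplicative.ofAdd.injective (he hcj)
    have hr0 : r = 0 := hfix r hr
    have hyt : y ^ t.val = 1 := by rw [htr2, hr0, ofAdd_zero, map_one]
    have ht : orderOf y ∣ t.val := orderOf_dvd_of_pow_eq_one hyt
    exact (ZMod.val_eq_zero t).1 (Nat.eq_zero_of_dvd_of_lt ht (ZMod.val_lt t))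
  have hqn : (m + 2) ∣ orderOf y := by
    rw [← orderOf_eq_prime hζ.out hζ1]
    exact orderOf_dvd_of_pow_eq_one hfact.out
  have hM : ¬ BoxUseful (RCyc R (orderOf y) ζ) :=
    not_boxUseful_of_surjective' (RCyc.redHom hqn) (RCyc.redHom_surjective hqn) hbad
  exact not_boxUseful_of_injective' _ hinj hM

end Cyclo

/-! ### The atoms `A(2,5)` and `A(3,5)` -/

namespace SchmidtAtoms

open Cyclo

/-- Coordinates of `𝔽₁₆` in the basis `1, ζ, ζ², ζ³` (`ζ = z16`). [folklore] -/
def lam16 : F16 →+ (Fin 4 → ZMod 2) where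
  toFun r := ![r.re.re, r.im.re, r.re.im + r.im.im, r.re.im + r.im.re]
  map_zero' := by decide
  map_add' := by decide

/-- Coordinates of `𝔽₈₁` in the basis `1, ζ, ζ², ζ³` (`ζ = z81`). [folklore] -/
def lam81 : F81 →+ (Fin 4 → ZMod 3) where
  toFun r := ![r.re.re + r.re.im + r.im.re + r.im.im, 2 * r.im.re + 2 * r.im.im, 2 * r.re.im + r.im.im,
    2 * r.re.im + 2 * r.im.re + r.im.im]
  map_zero' := by decide
  map_add' := by decide +kernel

/-- **`AtomBad 2 5`: the atom `A(2,5) = 𝔽₁₆ ⋊ C₅` in relation form** (from stpp-1's `not_boxUseful_f16c5`). [folklore] -/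
theorem atomBad_2_5 : AtomBad.{u} 2 5 := by
  have hbij : Function.Bijective lam16 := by decide
  have hmul : ∀ r : F16, lam16 (z16 * r) = shift (lam16 r) := by decide
  have hfix : ∀ r : F16, z16 * r = r → r = 0 := by decide
  have hreach : ∀ d : Fin (3 + 1) → ZMod 2, d ≠ 0 →
      ∃ ε : Fin (3 + 1) → ZMod 2, ∑ j : Fin (3 + 1), ε j • shift^[j.val] d = Pi.single 0 1 := by decide
  haveI : Fact (Nat.Prime 2) := ⟨Nat.prime_two⟩
  haveI : Fact (Nat.Prime 5) := ⟨by decide⟩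
  exact Cyclo.atomBad_of_model (m := 3) 5 rfl z16 z16_ne_one lam16 hbij hmul hfix hreach not_boxUseful_f16c5

/-- **`AtomBad 3 5`: the atom `A(3,5) = 𝔽₈₁ ⋊ C₅` in relation form** (from stpp-1's `not_boxUseful_f81c5`). [folklore] -/
theorem atomBad_3_5 : AtomBad.{u} 3 5 := by
  have hbij : Function.Bijective lam81 := by decide +kernel
  have hmul : ∀ r : F81, lam81 (z81 * r) = shift (lam81 r) := by decide +kernel
  have hfix : ∀ r : F81, z81 * r = r → r = 0 := by decide +kernel
  have hreach : ∀ d : Fin (3 + 1) → ZMod 3, d ≠ 0 →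
      ∃ ε : Fin (3 + 1) → ZMod 3, ∑ j : Fin (3 + 1), ε j • shift^[j.val] d = Pi.single 0 1 := by decide +kernel
  haveI : Fact (Nat.Prime 3) := ⟨Nat.prime_three⟩
  haveI : Fact (Nat.Prime 5) := ⟨by decide⟩
  exact Cyclo.atomBad_of_model (m := 3) 5 rfl z81 z81_ne_one lam81 hbij hmul hfix hreach not_boxUseful_f81c5

end SchmidtAtoms

end Summit.MatrixMultiplication.OmegaCensus
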